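import Mathlib
import Literature.Analysis.FluidPDE.Tao2016AveragedNS.SelfSimilarCascadeBlowup
import Literature.Analysis.FluidPDE.Tao2016AveragedNS.ViscousEternalSolutions
import Literature.Analysis.FluidPDE.Tao2016AveragedNS.BoundedEternalSolutions
import Summits.NavierStokesRegularity.NavierStokesRegularity.Theses.TaoLadderRungTwoBreak
import Summits.NavierStokesRegularity.NavierStokesRegularity.Theses.WakeRatchet
import Summits.NavierStokesRegularity.NavierStokesRegularity.Theorems.WakeRatchetAdmissibleEternalBoundPersistence
import Summits.NavierStokesRegularity.NavierStokesRegularity.Theorems.WakeRatchetAdmissibleEternalBoundDyadic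
import HarnessLib

/-!
# Crux `TaoLadderRungTwoBreak.NoSurvivingDSSOne` (stmt-NavierStokesRegularity-20205): its registered hard stub
# `stub_eternalLiouville` IS the (ρ0) child ⟨20451⟩ of K1ᵛ(1) MODULO the WakeRatchet crux `AdmissibleEternalBound`
# ⟨23197⟩ — and is (ρ0) outright on forward cascades and on the dyadic member (by name)

MODEL lattice ODEs only (Tao 2016 §4 in the log-time variables of §6.4; cell vocabulary `IsEternal`,
`IsEternalVisc`, `UniformBound`, `EternalSurvivingFwd`, `NoSurvivingEternalFwd`, `NoSurvivingEternalBdd`,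
`physFlux`); nothing in this file is a statement about the Navier–Stokes equations, and NO item is closed
by it (`--supports stmt-NavierStokesRegularity-20205 --as helper`).

The registered skeleton of ⟨20205⟩ (`NoSurvivingDSSOne_birth.lean`, sha16 `73b53d2f2a6a7842`) has one
open stub, `stub_eternalLiouville`, literally `∀ R ≥ 1, NoSurvivingEternalFwd R 1` (tree
`stubEternalLiouville_iff`): the inviscid Liouville theorem for ALL admissible eternal solutions, with NO
`UniformBound` clause.  The tree already records the downward link `stub_eternalLiouville ⟹ (ρ0)`
(`stub_noSurvivingEternalBddOne_of_stub_eternalLiouville`, forget the bound).  This file records the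
UPWARD links, i.e. exactly how much stronger the registered stub is than the (ρ0) child
`NoSurvivingEternalBddOne` ⟨20451⟩ of the deciding crux ⟨20419⟩:

* `noSurvivingEternalFwd_of_bdd_of_admissibleEternalBound` — at one spread `R`:
  `NoSurvivingEternalBdd R 1` + (the spread-`R` instance of) `WakeRatchet.AdmissibleEternalBound` ⟹
  `NoSurvivingEternalFwd R 1` (thresholds: the minimum of the two);
* `stub_eternalLiouville_of_rho0_of_admissibleEternalBound` — BY NAME: (ρ0) `NoSurvivingEternalBddOne`
  ⟨20451⟩ ∧ `WakeRatchet.AdmissibleEternalBound` ⟨23197⟩ ⟹ the registered stub of ⟨20205⟩ (signature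
  verbatim); with the tree's downward link, `stub_eternalLiouville_iff_rho0_of_admissibleEternalBound`:
  UNDER ⟨23197⟩ the hard stub of ⟨20205⟩ and the (ρ0) stub of ⟨20419⟩ are the SAME statement;
* `noSurvivingEternalFwd_onForwardCascades_of_bdd` — UNCONDITIONALLY on the no-backscatter class: (ρ0) at
  spread `R` gives the stub's conclusion for every admissible inviscid eternal solution all of whose bond
  fluxes are non-negative (such solutions are uniformly bounded by energy persistence, tree
  `WakeRatchetPersistence.uniformBound_of_forwardCascade`);
* `eternalLiouville_dyadic_of_rho0` — in particular on the dyadic member `dyadicTable ∈ E₂(2)` (all fluxes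
  are forward, tree `WakeRatchetDyadic.uniformBound_dyadic`): (ρ0) at spread `2` forbids survival of EVERY
  admissible inviscid eternal solution of the dyadic member below its threshold, bounded or not.

READING for the planner of ⟨20205⟩ (LAND-ONLY hand; no skeleton is touched here): the crux ⟨20205⟩ itself
needs only (ρ0) (tree `noSurvivingDSSOne_of_noSurvivingEternalBddOne`); its registered line asks for the
stronger `stub_eternalLiouville`, and the excess over (ρ0) is PRECISELY the open WakeRatchet crux ⟨23197⟩
(automatic type-I for admissible eternal solutions) off the forward-cascade class — a re-line of ⟨20205⟩
through the existing items ⟨20451⟩ (∧ ⟨23197⟩ if the stronger stub is wanted) loses nothing.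

HONEST LABEL: pure logic over the tree's predicates plus two tree theorems (energy persistence on forward
cascades, positivity of the dyadic member); the mathematical content — (ρ0), ⟨23197⟩ — is untouched;
⟨20205⟩, ⟨20419⟩, ⟨20451⟩, ⟨23197⟩ and every NS statement remain OPEN; rung 0.
-/

noncomputable section

-- the sub-problem namespace repeats the summit name by design (D-0017)
set_option linter.dupNamespace false

namespace Summit.NavierStokesRegularity.NavierStokesRegularity.Theorems.NoSurvivingDSSOne.EternalLiouvilleOfBounded

open Literature.Analysis.FluidPDE Literature.Analysis.FluidPDE.TaoCascade
open Summit.NavierStokesRegularity.NavierStokesRegularity.Theses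
open Summit.NavierStokesRegularity.NavierStokesRegularity.Theses.TaoLadderRungTwoBreak
open Summit.NavierStokesRegularity.NavierStokesRegularity.Theorems.WakeRatchetPersistence
  (uniformBound_of_forwardCascade)
open Summit.NavierStokesRegularity.NavierStokesRegularity.Theorems.WakeRatchetDyadic (uniformBound_dyadic)

/-! ### §1 At one spread: bounded Liouville + automatic boundedness ⟹ Liouville -/

/-- **`NoSurvivingEternalBdd R 1` + automatic type-I at spread `R` ⟹ `NoSurvivingEternalFwd R 1`.**  If below some
threshold every admissible viscous eternal solution (any `ν̂ ≥ 0`) of every E₂(R) table is uniformly bounded (the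
spread-`R` instance of `WakeRatchet.AdmissibleEternalBound`), then the bounded inviscid Liouville predicate at
spread `R` upgrades to the unrestricted one (threshold = the minimum of the two thresholds; an admissible
inviscid eternal solution is an admissible viscous one with `ν̂ = 0`, `IsEternal.isEternalVisc`).
[cite: Tao2016AveragedNS, §4 Thm. 4.2 (statement shape), §6.4; cell vocabulary] -/
theorem noSurvivingEternalFwd_of_bdd_of_admissibleEternalBound {R : ℝ} (h0 : NoSurvivingEternalBdd R 1)
    (hB : ∃ εs : ℝ, 0 < εs ∧ ∀ ε₀ : ℝ, 0 < ε₀ → ε₀ ≤ εs →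
      ∀ α : Fin 4 → Fin 4 → Fin 4 → ℤ × ℤ × ℤ → ℝ, InTableClass R α →
        ∀ (νh : ℝ) (W : ℤ → ℝ → Em 4), IsEternalVisc ε₀ νh α W → UniformBound W) :
    NoSurvivingEternalFwd R 1 := by
  obtain ⟨ε₁, hε₁, H0⟩ := h0
  obtain ⟨ε₂, hε₂, HB⟩ := hB
  refine ⟨min ε₁ ε₂, lt_min hε₁ hε₂, fun ε₀ hε₀ hle α hα W hW => ?_⟩
  exact H0 ε₀ hε₀ (hle.trans (min_le_left _ _)) α hα W hW
    (HB ε₀ hε₀ (hle.trans (min_le_right _ _)) α hα 0 W hW.isEternalVisc)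

/-! ### §2 By name: the hard stub of ⟨20205⟩ from (ρ0) ⟨20451⟩ and `AdmissibleEternalBound` ⟨23197⟩ -/

/-- **BY NAME: (ρ0) ∧ ⟨23197⟩ ⟹ `stub_eternalLiouville`.**  The split child (ρ0) `NoSurvivingEternalBddOne` of K1ᵛ(1)
(= the registered stub `stub_noSurvivingEternalBddOne` of ⟨20419⟩, item ⟨20451⟩) together with the WakeRatchet crux
`AdmissibleEternalBound` (item ⟨23197⟩: admissible viscous eternal solutions are uniformly bounded below a threshold)
gives the registered hard stub of ⟨20205⟩'s skeleton `73b53d2f2a6a7842`, SIGNATURE VERBATIM.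
[cite: Tao2016AveragedNS, §4 Thm. 4.2 (statement shape), §6.4; cell vocabulary] -/
theorem stub_eternalLiouville_of_rho0_of_admissibleEternalBound (h0 : NoSurvivingEternalBddOne)
    (hB : WakeRatchet.AdmissibleEternalBound) :
    ∀ R : ℝ, 1 ≤ R → ∃ εs : ℝ, 0 < εs ∧ ∀ ε₀ : ℝ, 0 < ε₀ → ε₀ ≤ εs →
      ∀ α : (Fin 4 → Fin 4 → Fin 4 → ℤ × ℤ × ℤ → ℝ), InTableClass R α →
        ∀ W : ℤ → ℝ → Em 4, IsEternal ε₀ α W → ¬ EternalSurvivingFwd 1 ε₀ W :=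
  fun R hR => noSurvivingEternalFwd_of_bdd_of_admissibleEternalBound (h0 R hR) (hB R hR)

/-- **Under ⟨23197⟩ the two stubs coincide.**  Assuming `WakeRatchet.AdmissibleEternalBound`, the hard stub
`stub_eternalLiouville` of ⟨20205⟩ (signature verbatim) is EQUIVALENT to the (ρ0) stub `stub_noSurvivingEternalBddOne` of
⟨20419⟩ = `NoSurvivingEternalBddOne` ⟨20451⟩ (→: forget the bound, tree `noSurvivingEternalBdd_of_fwd` — the link
`stub_noSurvivingEternalBddOne_of_stub_eternalLiouville` of `…Links`, no hypothesis needed; ←: `stub_eternalLiouville_of_rho0_of_admissibleEternalBound`).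
[cite: Tao2016AveragedNS, §4 Thm. 4.2 (statement shape), §6.4; cell vocabulary] -/
theorem stub_eternalLiouville_iff_rho0_of_admissibleEternalBound (hB : WakeRatchet.AdmissibleEternalBound) :
    (∀ R : ℝ, 1 ≤ R → ∃ εs : ℝ, 0 < εs ∧ ∀ ε₀ : ℝ, 0 < ε₀ → ε₀ ≤ εs →
      ∀ α : (Fin 4 → Fin 4 → Fin 4 → ℤ × ℤ × ℤ → ℝ), InTableClass R α →
        ∀ W : ℤ → ℝ → Em 4, IsEternal ε₀ α W → ¬ EternalSurvivingFwd 1 ε₀ W) ↔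
    NoSurvivingEternalBddOne :=
  ⟨fun h R hR => noSurvivingEternalBdd_of_fwd (h R hR),
    fun h0 => stub_eternalLiouville_of_rho0_of_admissibleEternalBound h0 hB⟩

/-- The same equivalence with the (ρ0) side written as the registered stub signature of ⟨20419⟩ /
the predicate family `NoSurvivingEternalBdd R 1` (`NoSurvivingEternalBddOne` unfolds to it by `Iff.rfl`).
[cite: Tao2016AveragedNS, §4 Thm. 4.2 (statement shape), §6.4; cell vocabulary] -/
theorem stub_eternalLiouville_iff_stub_noSurvivingEternalBddOne_of_admissibleEternalBound
    (hB : WakeRatchet.AdmissibleEternalBound) :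
    (∀ R : ℝ, 1 ≤ R → NoSurvivingEternalFwd R 1) ↔ (∀ R : ℝ, 1 ≤ R → NoSurvivingEternalBdd R 1) :=
  stub_eternalLiouville_iff_rho0_of_admissibleEternalBound hB

/-! ### §3 Unconditionally on forward cascades, and on the dyadic member -/

/-- **(ρ0) at spread `R` ⟹ the stub's conclusion on the NO-BACKSCATTER class, unconditionally.**  Below the threshold
of `NoSurvivingEternalBdd R 1`, an admissible INVISCID eternal solution of an E₂(R) table all of whose bond fluxes are
non-negative is not forward (S₁)-surviving — WITHOUT assuming `UniformBound`: forward cascades of cancelling tables are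
uniformly bounded by energy persistence (tree `WakeRatchetPersistence.uniformBound_of_forwardCascade`, bound
`M e^{C_A M/Λ}` from the per-shell action `M`).
[cite: Tao2016AveragedNS, §4 Thm. 4.2 (statement shape), Lemma 4.1 (4.8)–(4.10) with (4.3), §6.4; cell vocabulary] -/
theorem noSurvivingEternalFwd_onForwardCascades_of_bdd {R : ℝ} (h0 : NoSurvivingEternalBdd R 1) :
    ∃ εs : ℝ, 0 < εs ∧ ∀ ε₀ : ℝ, 0 < ε₀ → ε₀ ≤ εs →
      ∀ α : Fin 4 → Fin 4 → Fin 4 → ℤ × ℤ × ℤ → ℝ, InTableClass R α →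
        ∀ W : ℤ → ℝ → Em 4, IsEternal ε₀ α W → (∀ (k : ℤ) (σ : ℝ), 0 ≤ physFlux ε₀ α W k σ) →
          ¬ EternalSurvivingFwd 1 ε₀ W := by
  obtain ⟨εs, hεs, H0⟩ := h0
  refine ⟨εs, hεs, fun ε₀ hε₀ hle α hα W hW hF => ?_⟩
  exact H0 ε₀ hε₀ hle α hα W hW (uniformBound_of_forwardCascade hε₀ hα.2.1 hW hF)

/-- **BY NAME on the no-backscatter class**: (ρ0) `NoSurvivingEternalBddOne` ⟨20451⟩ gives `stub_eternalLiouville`'s statement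
restricted to forward cascades (extra binder `∀ k σ, 0 ≤ physFlux ε₀ α W k σ`), for every spread `R ≥ 1`, no other hypothesis.
[cite: Tao2016AveragedNS, §4 Thm. 4.2 (statement shape), §6.4; cell vocabulary] -/
theorem stub_eternalLiouville_onForwardCascades_of_rho0 (h0 : NoSurvivingEternalBddOne) :
    ∀ R : ℝ, 1 ≤ R → ∃ εs : ℝ, 0 < εs ∧ ∀ ε₀ : ℝ, 0 < ε₀ → ε₀ ≤ εs →
      ∀ α : (Fin 4 → Fin 4 → Fin 4 → ℤ × ℤ × ℤ → ℝ), InTableClass R α →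
        ∀ W : ℤ → ℝ → Em 4, IsEternal ε₀ α W → (∀ (k : ℤ) (σ : ℝ), 0 ≤ physFlux ε₀ α W k σ) →
          ¬ EternalSurvivingFwd 1 ε₀ W :=
  fun R hR => noSurvivingEternalFwd_onForwardCascades_of_bdd (h0 R hR)

/-- **On the dyadic member, (ρ0) already is the unrestricted Liouville theorem.**  If `NoSurvivingEternalBdd 2 1` holds (the
(ρ0) predicate at spread `2`, where `dyadicTable ∈ E₂(2)`, tree `inTableClass_dyadicTable`), then below its threshold NO
admissible inviscid eternal solution of the dyadic member — bounded or not — is forward (S₁)-surviving: admissible eternal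
solutions of `dyadicTable` are uniformly bounded outright (tree `WakeRatchetDyadic.uniformBound_dyadic`: non-negativity makes
them forward cascades).
[cite: Tao2016AveragedNS, §1.2 (dyadic model), §4 Thm. 4.2 (statement shape), §6.4; cell vocabulary] -/
theorem eternalLiouville_dyadic_of_rho0 (h0 : NoSurvivingEternalBdd 2 1) :
    ∃ εs : ℝ, 0 < εs ∧ ∀ ε₀ : ℝ, 0 < ε₀ → ε₀ ≤ εs →
      ∀ W : ℤ → ℝ → Em 4, IsEternal ε₀ dyadicTable W → ¬ EternalSurvivingFwd 1 ε₀ W := by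
  obtain ⟨εs, hεs, H0⟩ := h0
  refine ⟨εs, hεs, fun ε₀ hε₀ hle W hW => ?_⟩
  exact H0 ε₀ hε₀ hle dyadicTable (inTableClass_dyadicTable le_rfl) W hW (uniformBound_dyadic hε₀ hW)

/-- **BY NAME**: (ρ0) `NoSurvivingEternalBddOne` ⟨20451⟩ forbids survival of EVERY admissible inviscid eternal solution of the dyadic
member below the spread-`2` threshold (no `UniformBound` clause) — the dyadic slice of ⟨20205⟩'s hard stub follows from (ρ0) alone.
[cite: Tao2016AveragedNS, §1.2 (dyadic model), §4 Thm. 4.2 (statement shape), §6.4; cell vocabulary] -/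
theorem eternalLiouville_dyadic_of_noSurvivingEternalBddOne (h0 : NoSurvivingEternalBddOne) :
    ∃ εs : ℝ, 0 < εs ∧ ∀ ε₀ : ℝ, 0 < ε₀ → ε₀ ≤ εs →
      ∀ W : ℤ → ℝ → Em 4, IsEternal ε₀ dyadicTable W → ¬ EternalSurvivingFwd 1 ε₀ W :=
  eternalLiouville_dyadic_of_rho0 (h0 2 (by norm_num))

end Summit.NavierStokesRegularity.NavierStokesRegularity.Theorems.NoSurvivingDSSOne.EternalLiouvilleOfBounded

end
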